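import Summits.QuantumFields.YangMills.Theorems.BalabanUVNodesN22KnitVertex

/-!
# BalabanUVNodes ∕ N22 knit, ROAD 3 AT THE VERTEX, CENTRED FORM — the power weight on the DIFFERENCE from a vertex value:
# `‖F(z) − e₀‖ ≤ M·μ^{age}·t^{p}·e^{−κd}` on the relative discs `D̄(t, ct)` (instead of `‖F(z)‖ ≤ …`, which would force every young-coupling
# section to VANISH at the vertex — right for the last coupling by [Balaban1987RG1] p. 268, too strong for the older ones), with the same
# conclusion **NE9 ∧ FadingMemory at the rate `θ^{1−1∕p}μ^{1∕p}`** (Track A, DAG node N22 = NE9; cluster K4 «SpineRates»; seat `pub-ymgap-dag-n22-a`)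

HONEST FRAMING.  Count-neutral kernel bookkeeping over hypothesis shapes on the ABSTRACT carriers; NOT a node discharge; NE5 ∕ NE9 NOT IN PRINT,
NOT PROVED; instance 0∕1 (W1); one finite four-torus programme at fixed ε; nothing continuum ∕ ℝ⁴ ∕ OS ∕ mass-gap ∕ Clay.  0 `sorry`, 0 `def`,
standard axioms.  `--supports` item `SpineGivenEndpoint` (route «BalabanUVNodes», cluster K4).

WHY (a correction of SHAPE, not of a proof).  `BalabanUVNodesN22KnitVertex` §2 asks `‖F(z)‖ ≤ M·μ^{age}·t^{p}·e^{−κd}` on `D̄(t, ct)`: the section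
itself must then tend to `0` at the vertex in EVERY young coupling `g_i`, `i < scale X` — but an older term does not vanish when an older coupling
does (only the term born right after `g_i` does, p. 268 *«vanishes at g_k = 0»*).  The instance-facing shape is the CENTRED one: a vertex value
`e₀` (depending on the section) with `‖F(z) − e₀‖ ≤ M·μ^{age}·t^{p}·e^{−κd}`, i.e. the section approaches its vertex value to order `p` along the
relative discs.  The proofs are those of the uncentred file applied to `F − e₀` (same differences, same derivative):
* `deriv_bound_vertex_centered` — `N22KnitVertex.deriv_bound_vertex` for `F − e₀`.
* **`coordLipschitzOn_of_osc_analyticRelPowCentered`** ∕ **`ne9_and_fadingMemory_of_osc_analyticRelPowCentered`** — (P) + (O) (`C₀ > 0`,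
  `θ > 0`) + (A_p^c) centred power-weighted relative-disc analyticity (`c > 0`, `p ≥ 2`, `θ ≤ μ`) ⟹ `NE9 E (Window γ) κ Λ ∧ FadingMemory C₉ τ_p Λ`,
  `τ_p = θ^{1−1∕p}μ^{1∕p}`, `C₉ = (32p²∕c′)·C₀^{1−1∕p}(2M)^{1∕p}∕τ_p`, `c′ = min(c,1)∕2` — same constants as the uncentred form.
* (W2) `s_N22_of_oscAnalyticRelPowCentered` — the closer for the K4 stub `S_N22 RRec` at every rate-record predicate carrying the centred slot.
READING (census `N22-ROADS-CENSUS.md` v1.2): the vertex costs the ORDER `p` to which each young-coupling section approaches ITS OWN vertex value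
along (2.9)'s relative discs — `p ≥ 2` with `θ^{p−1}μ < 1` suffices; `p = 1` does not (rate `μ`); `N22KnitVertex` §4's quotient letter
(`θ^{age}` at first order) gives the rate `θ` directly.

References (TYPES only): [Balaban1987RG1] = T. Bałaban, Commun. Math. Phys. **109** (1987) 249–301 — p. 263, (2.9) p. 266, (2.13) p. 268.
-/

noncomputable section

namespace Summit.QuantumFields.YangMills.BalabanUVNodes.N22KnitVertexCentered

open Set Metric Complex Real Filter
open scoped Real Topology
open Summit.QuantumFields.YangMills.BalabanUVNodes.N22KnitVertex (deriv_bound_vertex abs_sub_le_of_deriv_bound)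

/-! ## §1 The centred derivative bound -/

/-- **THE VERTEX DERIVATIVE BOUND, CENTRED**: as `N22KnitVertex.deriv_bound_vertex` with the disc bound on `F − e₀` for a vertex value `e₀`
(`‖F(z) − e₀‖ ≤ M·μ^{a}·t^{p}·w` on `D̄(t, ct)`); same conclusion `‖F′(t)‖ ≤ (32p²∕c′)·C₀^{1−1∕p}(2M)^{1∕p}·(θ^{1−1∕p}μ^{1∕p})^{a}·w`. [folklore] -/
theorem deriv_bound_vertex_centered {F : ℂ → ℂ} {D : Set ℂ} {e₀ : ℂ} {t c C₀ θ M μ w σ : ℝ} {p a : ℕ} (hσ : σ = 1 ∨ σ = -1)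
    (ht : 0 < t) (hc : 0 < c) (hp : 2 ≤ p) (hC₀ : 0 < C₀) (hθ : 0 < θ) (hM : 0 < M) (hμ : 0 < μ) (hw : 0 < w)
    (hF : DifferentiableOn ℂ F D) (hD : closedBall (t : ℂ) (c * t) ⊆ D)
    (hB : ∀ z ∈ closedBall (t : ℂ) (c * t), ‖F z - e₀‖ ≤ M * μ ^ a * t ^ p * w)
    (hflat : ∀ u : ℝ, 0 ≤ u → u ≤ min c 1 / 2 * t → ‖F ((t + σ * u : ℝ) : ℂ) - F t‖ ≤ C₀ * θ ^ a * w) :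
    ‖deriv F t‖ ≤ 32 * (p : ℝ) ^ 2 / (min c 1 / 2) * (C₀ ^ (1 - (p : ℝ)⁻¹) * (2 * M) ^ (p : ℝ)⁻¹)
      * (θ ^ (1 - (p : ℝ)⁻¹) * μ ^ (p : ℝ)⁻¹) ^ a * w := by
  have h := deriv_bound_vertex (F := fun z => F z - e₀) (a := a) hσ ht hc hp hC₀ hθ hM hμ hw (hF.sub_const e₀) hD
    (fun z hz => hB z hz) (fun u hu0 hur => by simpa [sub_sub_sub_cancel_right] using hflat u hu0 hur)
  have hd : deriv (fun z => F z - e₀) (t : ℂ) = deriv F t := deriv_sub_const e₀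
  rwa [hd] at h

/-! ## §2 On the abstract carriers: the centred power-weighted slot -/

section Abstract

open Literature.MathematicalPhysics.QuantumFieldTheory.Balaban1983to89
open Literature.MathematicalPhysics.QuantumFieldTheory.Balaban1983to89.T4OutputRate
open Literature.MathematicalPhysics.QuantumFieldTheory.Balaban1983to89.T4CouplingAnalyticity
  (CoordLipschitzOn update_mem_boxWindow ne9_of_coordLipschitz)
open Summit.QuantumFields.YangMills.BalabanUVNodes.N22Knit (fadingMemory_geometric)

variable {C : Carriers} {Bg : Type} {E : Functional C Bg}

/-- **(O) + CENTRED POWER-WEIGHTED RELATIVE-DISC ANALYTICITY ⇒ COORDINATEWISE FADING MODULI AT THE RATE `θ^{1−1∕p}μ^{1∕p}`.**  As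
`N22KnitVertex.coordLipschitzOn_of_osc_analyticRelPow`, with the disc bounds on `F − e₀` for a vertex value `e₀` of each section. [folklore] -/
theorem coordLipschitzOn_of_osc_analyticRelPowCentered {γ κ C₀ θ M μ c : ℝ} {p : ℕ}
    (hO : ∀ g ∈ Window γ, ∀ g' ∈ Window γ, ∀ (U : Bg) (X : C.Dom) (a : ℕ), a ≤ C.scale X →
      (∀ n, a ≤ n → g n = g' n) → |E g U X - E g' U X| ≤ C₀ * θ ^ (C.scale X - a) * Real.exp (-(κ * C.d X)))
    (hA : ∀ g ∈ Window γ, ∀ (U : Bg) (X : C.Dom) (i : ℕ), i < C.scale X → ∃ (F : ℂ → ℂ) (D : Set ℂ) (e₀ : ℂ),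
      DifferentiableOn ℂ F D ∧ (∀ t ∈ Ioc (0 : ℝ) γ, closedBall (t : ℂ) (c * t) ⊆ D) ∧
      (∀ t ∈ Ioc (0 : ℝ) γ, ∀ z ∈ closedBall (t : ℂ) (c * t),
        ‖F z - e₀‖ ≤ M * μ ^ (C.scale X - 1 - i) * t ^ p * Real.exp (-(κ * C.d X))) ∧
      (∀ t ∈ Ioc (0 : ℝ) γ, F t = (E (Function.update g i t) U X : ℂ)))
    (hC₀ : 0 < C₀) (hθ : 0 < θ) (hM : 0 < M) (hθμ : θ ≤ μ) (hc : 0 < c) (hp : 2 ≤ p) :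
    CoordLipschitzOn (Ioc (0 : ℝ) γ) E κ
      (fun k i => 32 * (p : ℝ) ^ 2 / (min c 1 / 2) * (C₀ ^ (1 - (p : ℝ)⁻¹) * (2 * M) ^ (p : ℝ)⁻¹) / (θ ^ (1 - (p : ℝ)⁻¹) * μ ^ (p : ℝ)⁻¹)
        * (θ ^ (1 - (p : ℝ)⁻¹) * μ ^ (p : ℝ)⁻¹) ^ (k - i)) := by
  intro U X g hg i hi s₁ hs₁ s₂ hs₂
  set s : ℝ := (p : ℝ)⁻¹ with hs
  set a : ℕ := C.scale X - 1 - i with ha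
  set w : ℝ := Real.exp (-(κ * C.d X)) with hw
  have hw0 : 0 < w := Real.exp_pos _
  have hμ : 0 < μ := hθ.trans_le hθμ
  set τ : ℝ := θ ^ (1 - s) * μ ^ s with hτ
  have hτ0 : 0 < τ := mul_pos (Real.rpow_pos_of_pos hθ _) (Real.rpow_pos_of_pos hμ _)
  set c' : ℝ := min c 1 / 2 with hc'
  have hc'0 : 0 < c' := by rw [hc']; positivity
  have hc'1 : c' ≤ 1 / 2 := by have := min_le_right c 1; rw [hc']; linarith
  set K : ℝ := 32 * (p : ℝ) ^ 2 / c' * (C₀ ^ (1 - s) * (2 * M) ^ s) with hKdef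
  obtain ⟨F, D, e₀, hF, hD, hFB, hf⟩ := hA g hg U X i hi
  set f : ℝ → ℝ := fun t => E (Function.update g i t) U X with hfdef
  have hflat : ∀ x ∈ Ioc (0 : ℝ) γ, ∀ y ∈ Ioc (0 : ℝ) γ, |f x - f y| ≤ C₀ * θ ^ a * w := by
    intro x hx y hy
    have hagree : ∀ n, i + 1 ≤ n → Function.update g i x n = Function.update g i y n := fun n hn => by
      have hni : n ≠ i := by omega
      rw [Function.update_of_ne hni, Function.update_of_ne hni]
    have h := hO _ (update_mem_boxWindow hg i hx) _ (update_mem_boxWindow hg i hy) U X (i + 1) (by omega) hagree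
    rwa [show C.scale X - (i + 1) = a by omega] at h
  have hderiv : ∀ t ∈ Ioc (0 : ℝ) γ, ‖deriv F t‖ ≤ K * τ ^ a * w := by
    intro t ht
    have hflat1 : ∀ σ : ℝ, (σ = 1 ∨ σ = -1) → (∀ u : ℝ, 0 ≤ u → u ≤ c' * t → t + σ * u ∈ Ioc (0 : ℝ) γ) →
        ∀ u : ℝ, 0 ≤ u → u ≤ min c 1 / 2 * t → ‖F ((t + σ * u : ℝ) : ℂ) - F t‖ ≤ C₀ * θ ^ a * w := by
      intro σ _ hmem u hu0 hur
      have hm := hmem u hu0 hur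
      rw [hf _ hm, hf _ ht, ← Complex.ofReal_sub, Complex.norm_real, Real.norm_eq_abs]
      exact hflat _ hm _ ht
    have key : ∀ σ : ℝ, (σ = 1 ∨ σ = -1) → (∀ u : ℝ, 0 ≤ u → u ≤ c' * t → t + σ * u ∈ Ioc (0 : ℝ) γ) →
        ‖deriv F t‖ ≤ K * τ ^ a * w := by
      intro σ hσ hmem
      have h := deriv_bound_vertex_centered (a := a) hσ ht.1 hc hp hC₀ hθ hM hμ hw0 hF (hD t ht) (hFB t ht) (hflat1 σ hσ hmem)
      have e : 32 * (p : ℝ) ^ 2 / (min c 1 / 2) * (C₀ ^ (1 - (p : ℝ)⁻¹) * (2 * M) ^ (p : ℝ)⁻¹)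
          * (θ ^ (1 - (p : ℝ)⁻¹) * μ ^ (p : ℝ)⁻¹) ^ a * w = K * τ ^ a * w := by
        rw [hKdef, hτ, hs, hc']
      exact h.trans_eq e
    by_cases htr : t + c' * t ≤ γ
    · exact key 1 (Or.inl rfl) fun u hu0 hur => ⟨by linarith [ht.1], by linarith⟩
    · have htr : γ < t + c' * t := not_le.mp htr
      refine key (-1) (Or.inr rfl) fun u hu0 hur => ⟨?_, by linarith [ht.2]⟩
      have : c' * t ≤ t / 2 := by nlinarith [ht.1]
      linarith [ht.1]
  have hDn : ∀ t ∈ Ioc (0 : ℝ) γ, D ∈ 𝓝 (t : ℂ) := fun t ht =>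
    mem_nhds_iff.mpr ⟨ball (t : ℂ) (c * t), ball_subset_closedBall.trans (hD t ht), isOpen_ball, mem_ball_self (mul_pos hc ht.1)⟩
  have hmain : |f s₁ - f s₂| ≤ K * τ ^ a * w * |s₁ - s₂| := abs_sub_le_of_deriv_bound hF hDn hf hderiv hs₁ hs₂
  have hscale : C.scale X - i = a + 1 := by omega
  show |f s₁ - f s₂| ≤ w * (K / τ * τ ^ (C.scale X - i) * |s₁ - s₂|)
  rw [hscale, pow_succ]
  calc |f s₁ - f s₂| ≤ K * τ ^ a * w * |s₁ - s₂| := hmain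
    _ = w * (K / τ * (τ ^ a * τ) * |s₁ - s₂|) := by field_simp

/-- **ROAD 3 AT THE VERTEX, CENTRED — NODE N22 FROM (P) + (O) + CENTRED POWER-WEIGHTED RELATIVE-DISC ANALYTICITY.**  (P); (O) with `C₀ > 0` at
the tower rate `θ > 0`; (A_p^c): each young-coupling section extends analytically to the relative discs `D̄(t, ct)`, `t ∈ ]0, γ]`, approaching a
vertex value `e₀` to order `p ≥ 2`: `‖F(z) − e₀‖ ≤ M·μ^{age−1}·t^{p}·e^{−κd(X)}` (any `μ ≥ θ`).  Then **`NE9 E (Window γ) κ Λ ∧ FadingMemory C₉ τ_p Λ`**,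
`τ_p = θ^{1−1∕p}μ^{1∕p}`, `Λ k i = C₉·τ_p^{k−i}`, `C₉ = (32p²∕c′)·C₀^{1−1∕p}(2M)^{1∕p}∕τ_p` — node N22's statement of record BY NAME. [folklore] -/
theorem ne9_and_fadingMemory_of_osc_analyticRelPowCentered {γ κ C₀ θ M μ c : ℝ} {p : ℕ} (hP : PrefixDependenceOn E (Window γ))
    (hO : ∀ g ∈ Window γ, ∀ g' ∈ Window γ, ∀ (U : Bg) (X : C.Dom) (a : ℕ), a ≤ C.scale X →
      (∀ n, a ≤ n → g n = g' n) → |E g U X - E g' U X| ≤ C₀ * θ ^ (C.scale X - a) * Real.exp (-(κ * C.d X)))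
    (hA : ∀ g ∈ Window γ, ∀ (U : Bg) (X : C.Dom) (i : ℕ), i < C.scale X → ∃ (F : ℂ → ℂ) (D : Set ℂ) (e₀ : ℂ),
      DifferentiableOn ℂ F D ∧ (∀ t ∈ Ioc (0 : ℝ) γ, closedBall (t : ℂ) (c * t) ⊆ D) ∧
      (∀ t ∈ Ioc (0 : ℝ) γ, ∀ z ∈ closedBall (t : ℂ) (c * t),
        ‖F z - e₀‖ ≤ M * μ ^ (C.scale X - 1 - i) * t ^ p * Real.exp (-(κ * C.d X))) ∧
      (∀ t ∈ Ioc (0 : ℝ) γ, F t = (E (Function.update g i t) U X : ℂ)))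
    (hC₀ : 0 < C₀) (hθ : 0 < θ) (hM : 0 < M) (hθμ : θ ≤ μ) (hc : 0 < c) (hp : 2 ≤ p) :
    NE9 E (Window γ) κ
        (fun k i => 32 * (p : ℝ) ^ 2 / (min c 1 / 2) * (C₀ ^ (1 - (p : ℝ)⁻¹) * (2 * M) ^ (p : ℝ)⁻¹) / (θ ^ (1 - (p : ℝ)⁻¹) * μ ^ (p : ℝ)⁻¹)
          * (θ ^ (1 - (p : ℝ)⁻¹) * μ ^ (p : ℝ)⁻¹) ^ (k - i)) ∧
      FadingMemory (32 * (p : ℝ) ^ 2 / (min c 1 / 2) * (C₀ ^ (1 - (p : ℝ)⁻¹) * (2 * M) ^ (p : ℝ)⁻¹) / (θ ^ (1 - (p : ℝ)⁻¹) * μ ^ (p : ℝ)⁻¹))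
        (θ ^ (1 - (p : ℝ)⁻¹) * μ ^ (p : ℝ)⁻¹)
        (fun k i => 32 * (p : ℝ) ^ 2 / (min c 1 / 2) * (C₀ ^ (1 - (p : ℝ)⁻¹) * (2 * M) ^ (p : ℝ)⁻¹) / (θ ^ (1 - (p : ℝ)⁻¹) * μ ^ (p : ℝ)⁻¹)
          * (θ ^ (1 - (p : ℝ)⁻¹) * μ ^ (p : ℝ)⁻¹) ^ (k - i)) := by
  have hμ : 0 < μ := hθ.trans_le hθμ
  have hτ0 : 0 < θ ^ (1 - (p : ℝ)⁻¹) * μ ^ (p : ℝ)⁻¹ := mul_pos (Real.rpow_pos_of_pos hθ _) (Real.rpow_pos_of_pos hμ _)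
  have hC₉ : 0 ≤ 32 * (p : ℝ) ^ 2 / (min c 1 / 2) * (C₀ ^ (1 - (p : ℝ)⁻¹) * (2 * M) ^ (p : ℝ)⁻¹) / (θ ^ (1 - (p : ℝ)⁻¹) * μ ^ (p : ℝ)⁻¹) := by
    have h1 : 0 ≤ C₀ ^ (1 - (p : ℝ)⁻¹) := Real.rpow_nonneg hC₀.le _
    have h2 : 0 ≤ (2 * M) ^ (p : ℝ)⁻¹ := Real.rpow_nonneg (by linarith) _
    have h3 : 0 < min c 1 / 2 := by positivity
    positivity
  exact ⟨ne9_of_coordLipschitz hP (coordLipschitzOn_of_osc_analyticRelPowCentered hO hA hC₀ hθ hM hθμ hc hp),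
    fadingMemory_geometric hC₉ hτ0.le⟩

end Abstract

/-! ## §3 At the record (plan word (W2)): the centred vertex slot's closer -/

section AtRecord

open Literature.MathematicalPhysics.QuantumFieldTheory.Balaban1983to89
open Literature.MathematicalPhysics.QuantumFieldTheory.Balaban1983to89.T4Continuum
open Literature.MathematicalPhysics.QuantumFieldTheory.Balaban1983to89.T4OutputRate
open YMDAG.UVSplit

/-- **`S_N22 RRec` FOR EVERY `RRec` WHOSE U3 BUNDLES CARRY THE CENTRED VERTEX SLOT** (window `Window γ`, (P), (O) at the bundle's `θ`, (A_p^c)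
with letters `ω = θ^{1−1∕p}μ^{1∕p}`, `Λ k i = C₉ω^{k−i}`, `C₉` as in §2) — refinement-generic; combine with `YMDAG.N22.s_N22_of_refines`. [folklore] -/
theorem s_N22_of_oscAnalyticRelPowCentered {N : ℕ} [NeZero N] (RRec : RateRecordPred N)
    (hslot : ∀ (F : T4Family) (D : Datum F N) (g₀ : ℕ → ℝ) (os : List (ULoop F)) (R : RateCarriers N), RRec F D g₀ os R →
      ∃ (C₀ M μ c : ℝ) (p : ℕ), R.u3.W = Window R.u3.γ ∧ PrefixDependenceOn R.u3.EA (Window R.u3.γ) ∧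
        (∀ g ∈ Window R.u3.γ, ∀ g' ∈ Window R.u3.γ, ∀ (U : R.u3.C.BgA) (X : R.u3.C.Dom) (a : ℕ), a ≤ R.u3.C.scale X →
          (∀ n, a ≤ n → g n = g' n) →
            |R.u3.EA g U X - R.u3.EA g' U X| ≤ C₀ * R.u3.θ ^ (R.u3.C.scale X - a) * Real.exp (-(R.u3.κ * R.u3.C.d X))) ∧
        (∀ g ∈ Window R.u3.γ, ∀ (U : R.u3.C.BgA) (X : R.u3.C.Dom) (i : ℕ), i < R.u3.C.scale X →
          ∃ (Fz : ℂ → ℂ) (Dset : Set ℂ) (e₀ : ℂ),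
          DifferentiableOn ℂ Fz Dset ∧ (∀ t ∈ Ioc (0 : ℝ) R.u3.γ, closedBall (t : ℂ) (c * t) ⊆ Dset) ∧
          (∀ t ∈ Ioc (0 : ℝ) R.u3.γ, ∀ z ∈ closedBall (t : ℂ) (c * t),
            ‖Fz z - e₀‖ ≤ M * μ ^ (R.u3.C.scale X - 1 - i) * t ^ p * Real.exp (-(R.u3.κ * R.u3.C.d X))) ∧
          (∀ t ∈ Ioc (0 : ℝ) R.u3.γ, Fz t = (R.u3.EA (Function.update g i t) U X : ℂ))) ∧
        0 < C₀ ∧ 0 < R.u3.θ ∧ 0 < M ∧ R.u3.θ ≤ μ ∧ 0 < c ∧ 2 ≤ p ∧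
        R.u3.ω = R.u3.θ ^ (1 - (p : ℝ)⁻¹) * μ ^ (p : ℝ)⁻¹ ∧ (R.u3.Λ = fun k i => R.u3.C₉ * R.u3.ω ^ (k - i)) ∧
        R.u3.C₉ = 32 * (p : ℝ) ^ 2 / (min c 1 / 2) * (C₀ ^ (1 - (p : ℝ)⁻¹) * (2 * M) ^ (p : ℝ)⁻¹) /
          (R.u3.θ ^ (1 - (p : ℝ)⁻¹) * μ ^ (p : ℝ)⁻¹)) :
    S_N22 RRec := by
  intro F D g₀ os R hR
  obtain ⟨C₀, M, μ, c, p, hW, hP, hO, hA, hC₀, hθ, hM, hθμ, hc, hp, hω, hΛ, hC₉⟩ := hslot F D g₀ os R hR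
  show NE9 R.u3.EA R.u3.W R.u3.κ R.u3.Λ ∧ FadingMemory R.u3.C₉ R.u3.ω R.u3.Λ
  rw [hW, hΛ, hC₉, hω]
  exact ne9_and_fadingMemory_of_osc_analyticRelPowCentered hP hO hA hC₀ hθ hM hθμ hc hp

end AtRecord

end Summit.QuantumFields.YangMills.BalabanUVNodes.N22KnitVertexCentered

end
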